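import Summits.QuantumFields.YangMills.Theorems.BalabanUVNodesN15CurvedGluingLocalGaugesUN
import Summits.QuantumFields.YangMills.Theorems.BalabanUVNodesN15CurvedPerturbationLettersUN
import HarnessLib

/-!
# Route «BalabanUVNodes» (cluster K4 «SpineRates»), Track-A DAG node N15 = NE2, BACKGROUND LAYER — THE LOCAL OPERATOR OF A `U(N)` CUBE GAUGE IS THE FLAT LAPLACIAN MINUS THE SPECIES OF THE
# GAUGE-TRANSFORMED BOND VARIABLES `U^u_μ(x) = u(x)U_μ(x)u(x + e_μ)ᴴ`, AND ITS PERTURBATION LETTER `hV` IS READ OFF `‖U^u − 1‖_F`, `‖U^u_μ − U^u_μ(· − e_μ)‖_F` — the last link of the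
# per-cube road: (3.35) gauge on the cube (FILES 3∕4) → species letter in that gauge (FILE 2) → local parametrix (files 34–45) → gluing across gauges (FILES 7–10)

Cell `pub-ymgap`, seat `pub-ymgap-dag-n15-w2` (WIDTH SEAT 2∕3 on node N15, director-ym №197 ∕ HUMAN RULING D-0149), g5, eleventh piece (bus CLAIM-11).  `bears_on: R4∕N15 · K3⁸
SpineGivenEndpointR13SepCoPHV (stmt-QuantumFields-27366)`.  Filed `--kind proof --supports stmt-QuantumFields-27366 --as helper` — COUNT-NEUTRAL.  Theorems only; 0 `def`, 0 `sorry`.  Imports BY NAME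
this seat's `…CurvedGluingLocalGaugesUN` (`localOp_species_form`; through it g2 `trGaugeActFwd_conj_eq`, `uN_siteGauge_orthogonal`) and `…CurvedPerturbationLettersUN`
(`uN_hasMaj_unstackM_tCoef_gaugePair_group_rate`, `uN_conj_unitary`-type algebra); nothing in the tree is modified, no landed name re-declared.

WHY.  [Balaban1985BackgroundPropagators] Cor. 3.6 p. 408: «Applying the gauge transformation u we get U′ = U^u = e^{iηA} with A satisfying the inequalities in (3.35) … This implies that U′
satisfies (3.37) … with U = 1».  In the tree's words: with `W(x) = coordMat e (Ad_{u(x)})` and the background transporters `R_μ(x) = coordMat e (Ad_{U_μ(x)})`, the gauge-transformed transporter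
field IS the transporter field of the transformed bond variables (g2 `trGaugeActFwd_conj_eq`), so FILE 9's `localOp_species_form` reads: the LOCAL operator of the cube is
`Σ∇*∇ + P^W − V̂_{U^u}∘jet` with `V̂_{U^u}` the flat-base-point species of `U^u` — and FILE 2's group-level letter applies to `U^u` (unitary) verbatim.
* §1 `uN_gaugeTransformed_bond_unitary` (`U^u` is unitary bondwise), ★ `uN_trGaugeActFwd_conj_field` (the transformed transporter FIELD, `funext` of g2's pointwise identity);
* §2 ★★★ `uN_localOp_species_form` (`M_W(Δ_{R_U} + P)M_{Wᵀ} = lapOp η⁻¹ (liftEquiv∘τ) 0 + M_WPM_{Wᵀ} − V̂_{U^u}∘jet_{η⁻¹}`, `V̂_{U^u} = unstackM (tCoefC η Rp) (tCoefA η Rp)`,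
  `Rp = gaugePair τ (μ x ↦ coordMat e (Ad_{U^u_μ(x)}))`);
* §3 ★★★ `uN_hasMaj_localSpecies_rate` — the cube device's `hV` for `V̂_{U^u}` from the letters IN THE CUBE's GAUGE: `‖U^u_μ(x) − 1‖_F ≤ ηa` (for the axial gauge of a plaquette-small cube:
  FILES 3∕4), `‖U^u_μ(x) − U^u_μ(x − e_μ)‖_F ≤ η²b` (the second (3.35) letter, displayed): `V̂_{U^u} ≤ r_V(κ_e 2√|n| a, κ_e 2√|n| b)(1 + |J ⊕ J|)·e^{−δ_Vd}` for every `δ_V`.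

HONEST FRAMING ∕ LIMITS.  Bookkeeping ((3.34)–(3.37) p. 396, (3.50)–(3.53) p. 400, Cor. 3.6 p. 408 = SHAPES ∕ MECHANISM); the cube gauge `u`, the bond-variable letters in that gauge and every row
of the device are HYPOTHESES (the second (3.35) letter is NOT produced anywhere in the tree); nothing of [B5]∕[B6]∕[B9] asserted; NE2⁺ NOT PRINTED, NOT proved; N15 NOT discharged; K3⁸ OPEN,
skeleton v6 untouched; counts of record UNMOVED (typed 28∕28 · discharged 5∕27 · A 5∕28); one finite 𝕋⁴ at fixed ε — NOT ℝ⁴ ∕ OS ∕ mass gap ∕ Clay; R4 closes the conditional finite-𝕋⁴ rung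
`BalabanLadder.UV` only.  Restate-immune (no Theses import).
-/

set_option autoImplicit false

noncomputable section
open scoped BigOperators Matrix Matrix.Norms.Frobenius

namespace Summit.QuantumFields.YangMills.BalabanUVNodes.N15.CurvedSpecies

open Literature.MathematicalPhysics.QuantumFieldTheory.Balaban1983to89
open Literature.MathematicalPhysics.QuantumFieldTheory.Balaban1983to89.B11SectG (BlockNorm HasMaj)
open Summit.QuantumFields.YangMills.BalabanUVNodes.N15.MatrixSpecies (mmulOp liftBlk liftEquiv coordMat basisConst basisConst_nonneg)
open Summit.QuantumFields.YangMills.BalabanUVNodes.N15.BackgroundLayer (covLapM tCoefA tCoefC unstackM stack fgrad bgrad blkPair)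
open Summit.QuantumFields.YangMills.BalabanUVNodes.N15.Gluing (lapOp)
open Literature.Barriers.QuantumFields (traceForm)

variable {n : Type} [Fintype n] [DecidableEq n] {κ : Type} [Fintype κ] [DecidableEq κ] (e : Matrix n n ℂ ≃L[ℝ] (κ → ℝ))
variable {X J : Type} (τ : J → X ≃ X) (u : X → Matrix n n ℂ) (U : J → X → Matrix n n ℂ)

/-! ## §1 The gauge-transformed bond variables -/

/-- `U^u_μ(x) = u(x)U_μ(x)u(x + e_μ)ᴴ` is unitary when `u` and `U` are. [folklore] -/
theorem uN_gaugeTransformed_bond_unitary (hu : ∀ x, (u x)ᴴ * u x = 1) (hU : ∀ μ x, (U μ x)ᴴ * U μ x = 1) (μ : J) (x : X) :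
    (u x * U μ x * (u (τ μ x))ᴴ)ᴴ * (u x * U μ x * (u (τ μ x))ᴴ) = 1 := by
  have hu' : u (τ μ x) * (u (τ μ x))ᴴ = 1 := mul_eq_one_comm.mp (hu (τ μ x))
  rw [Matrix.conjTranspose_mul, Matrix.conjTranspose_mul, Matrix.conjTranspose_conjTranspose]
  calc u (τ μ x) * ((U μ x)ᴴ * (u x)ᴴ) * (u x * U μ x * (u (τ μ x))ᴴ)
      = u (τ μ x) * ((U μ x)ᴴ * (((u x)ᴴ * u x) * U μ x)) * (u (τ μ x))ᴴ := by simp only [Matrix.mul_assoc]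
    _ = 1 := by rw [hu, Matrix.one_mul, hU, Matrix.mul_one, hu']

/-- ★ **THE GAUGE-TRANSFORMED TRANSPORTER FIELD IS THE TRANSPORTER FIELD OF THE TRANSFORMED BOND VARIABLES** (g2 `trGaugeActFwd_conj_eq`, as an identity of fields):
`(R_U)^{W_u} = R_{U^u}`. [cite: Balaban1985BackgroundPropagators, (3.34)–(3.35) p.396, (3.50) p.400 (shape)] -/
theorem uN_trGaugeActFwd_conj_field (he : ∀ A B : Matrix n n ℂ, traceForm A B = e A ⬝ᵥ e B) (hu : ∀ x, (u x)ᴴ * u x = 1) :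
    trGaugeActFwd τ (fun x => coordMat e (ContinuousLinearMap.mulLeftRight ℝ (Matrix n n ℂ) (u x) (u x)ᴴ))
        (fun μ x => coordMat e (ContinuousLinearMap.mulLeftRight ℝ (Matrix n n ℂ) (U μ x) (U μ x)ᴴ)) =
      fun μ x => coordMat e (ContinuousLinearMap.mulLeftRight ℝ (Matrix n n ℂ) (u x * U μ x * (u (τ μ x))ᴴ) (u x * U μ x * (u (τ μ x))ᴴ)ᴴ) := by
  funext μ x
  exact trGaugeActFwd_conj_eq e τ u U he hu μ x

/-! ## §2 The local operator of a `U(N)` cube gauge in the species device's format -/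

section LocalOp

variable [Fintype X] [DecidableEq X] [Fintype J] [DecidableEq J] (η : ℝ)

/-- ★★★ **THE LOCAL OPERATOR IS THE FLAT LAPLACIAN MINUS THE SPECIES OF THE TRANSFORMED BOND VARIABLES**: for a unitary site field `u` (`W = coordMat e (Ad_u)`), unitary bond variables `U`
(`R_U = coordMat e (Ad_U)`) and any remainder `P`,
`M_W(Δ_{R_U} + P)M_{Wᵀ} = lapOp η⁻¹ (liftEquiv∘τ) 0 + M_WPM_{Wᵀ} − unstackM (tCoefC η Rp) (tCoefA η Rp)∘jet_{η⁻¹}`, `Rp = gaugePair τ R_{U^u}` — Cor. 3.6's «U′ = U^u … with U = 1» as an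
operator identity. [cite: Balaban1985BackgroundPropagators, (3.34)–(3.35) p.396, (3.50)–(3.53) p.400, Cor. 3.6 p.408] -/
theorem uN_localOp_species_form (he : ∀ A B : Matrix n n ℂ, traceForm A B = e A ⬝ᵥ e B) (hu : ∀ x, (u x)ᴴ * u x = 1) (P : (X × κ → ℝ) →ₗ[ℝ] (X × κ → ℝ)) :
    mmulOp (fun x => coordMat e (ContinuousLinearMap.mulLeftRight ℝ (Matrix n n ℂ) (u x) (u x)ᴴ)) ∘ₗ
        (covLapM τ η (gaugePair τ fun μ x => coordMat e (ContinuousLinearMap.mulLeftRight ℝ (Matrix n n ℂ) (U μ x) (U μ x)ᴴ)) + P) ∘ₗ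
        mmulOp (fun x => (coordMat e (ContinuousLinearMap.mulLeftRight ℝ (Matrix n n ℂ) (u x) (u x)ᴴ))ᵀ) =
      lapOp η⁻¹ (fun μ => liftEquiv (τ μ) κ) 0 +
        mmulOp (fun x => coordMat e (ContinuousLinearMap.mulLeftRight ℝ (Matrix n n ℂ) (u x) (u x)ᴴ)) ∘ₗ P ∘ₗ
          mmulOp (fun x => (coordMat e (ContinuousLinearMap.mulLeftRight ℝ (Matrix n n ℂ) (u x) (u x)ᴴ))ᵀ) -
        unstackM (tCoefC η (gaugePair τ fun μ x => coordMat e (ContinuousLinearMap.mulLeftRight ℝ (Matrix n n ℂ) (u x * U μ x * (u (τ μ x))ᴴ) (u x * U μ x * (u (τ μ x))ᴴ)ᴴ)))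
            (tCoefA η (gaugePair τ fun μ x => coordMat e (ContinuousLinearMap.mulLeftRight ℝ (Matrix n n ℂ) (u x * U μ x * (u (τ μ x))ᴴ) (u x * U μ x * (u (τ μ x))ᴴ)ᴴ))) ∘ₗ
          stack LinearMap.id (fun j : J ⊕ J => Sum.elim (fun μ => fgrad η⁻¹ (liftEquiv (τ μ) κ)) (fun μ => bgrad η⁻¹ (liftEquiv (τ μ) κ)) j) := by
  rw [localOp_species_form η τ _ _ (fun x => (uN_siteGauge_orthogonal e u he hu x).1) P, uN_trGaugeActFwd_conj_field e τ u U he hu]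

end LocalOp

/-! ## §3 The cube device's perturbation letter for the local species, from the bond-variable letters in the cube's gauge -/

section Letter

variable [Fintype X] [DecidableEq X] [Fintype J] [DecidableEq J] {g : B6.Geometry} (blk : X → g.Site) (η : ℝ)

omit [DecidableEq X] [DecidableEq J] in
/-- ★★★ **`hV` FOR THE LOCAL SPECIES OF A `U(N)` CUBE GAUGE**: unitary `u`, `U`; the letters of the TRANSFORMED bond variables `U^u_μ(x) = u(x)U_μ(x)u(x + e_μ)ᴴ` in the cube's gauge —
`‖U^u_μ(x) − 1‖_F ≤ ηa` (FILES 3∕4 for the axial gauge of a plaquette-small box), `‖U^u_μ(x) − U^u_μ(x − e_μ)‖_F ≤ η²b` (displayed) —, `η > 0`, `d(y, y) = 0` ⟹ the species of the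
gauge-transformed background, `unstackM (tCoefC η Rp) (tCoefA η Rp)`, `Rp = gaugePair τ (R_U)^{W_u}`, satisfies files 23∕25∕44's `hV` with `r_V(κ_e 2√|n| a, κ_e 2√|n| b)(1 + |J ⊕ J|)·e^{−δ_Vd}`
for every `δ_V` (FILE 2 at `U^u`, read through `uN_trGaugeActFwd_conj_field`). [cite: Balaban1985BackgroundPropagators, (3.35)–(3.37) p.396, (3.52)–(3.53) p.400, Cor. 3.6 p.408 (shapes)] -/
theorem uN_hasMaj_localSpecies_rate (he : ∀ A B : Matrix n n ℂ, traceForm A B = e A ⬝ᵥ e B) (hu : ∀ x, (u x)ᴴ * u x = 1) (hU : ∀ μ x, (U μ x)ᴴ * U μ x = 1)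
    (hd0 : ∀ y : g.Site, g.dist y y = 0) {a b : ℝ} (hη : 0 < η) (ha : 0 ≤ a) (hb : 0 ≤ b) (hUa : ∀ μ x, ‖u x * U μ x * (u (τ μ x))ᴴ - 1‖ ≤ η * a)
    (hUb : ∀ μ x, ‖u x * U μ x * (u (τ μ x))ᴴ - u ((τ μ).symm x) * U μ ((τ μ).symm x) * (u (τ μ ((τ μ).symm x)))ᴴ‖ ≤ η ^ 2 * b) (δV : ℝ) :
    HasMaj (BlockNorm.ofBlocks g (blkPair (liftBlk blk κ))) (BlockNorm.ofBlocks g (liftBlk blk κ))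
      (unstackM (tCoefC η (gaugePair τ (trGaugeActFwd τ (fun x => coordMat e (ContinuousLinearMap.mulLeftRight ℝ (Matrix n n ℂ) (u x) (u x)ᴴ))
            (fun μ x => coordMat e (ContinuousLinearMap.mulLeftRight ℝ (Matrix n n ℂ) (U μ x) (U μ x)ᴴ)))))
        (tCoefA η (gaugePair τ (trGaugeActFwd τ (fun x => coordMat e (ContinuousLinearMap.mulLeftRight ℝ (Matrix n n ℂ) (u x) (u x)ᴴ))
            (fun μ x => coordMat e (ContinuousLinearMap.mulLeftRight ℝ (Matrix n n ℂ) (U μ x) (U μ x)ᴴ))))))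
      (fun y y' => curvRowLetter κ J (basisConst e * (2 * Real.sqrt (Fintype.card n)) * a) (basisConst e * (2 * Real.sqrt (Fintype.card n)) * b) * (1 + Fintype.card (J ⊕ J)) *
        Real.exp (-(δV * g.dist y y'))) := by
  rw [uN_trGaugeActFwd_conj_field e τ u U he hu]
  exact uN_hasMaj_unstackM_tCoef_gaugePair_group_rate e blk η τ (fun μ x => u x * U μ x * (u (τ μ x))ᴴ) he (uN_gaugeTransformed_bond_unitary τ u U hu hU) hd0 hη ha hb hUa
    (fun μ x => hUb μ x) δV

end Letter

end Summit.QuantumFields.YangMills.BalabanUVNodes.N15.CurvedSpecies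

end
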